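import Summits.ResolutionOfSingularities.ResolutionOfSingularities.Theorems.EquisingularLiftEquisingularLiftNatInvStepRegular
import Summits.ResolutionOfSingularities.ResolutionOfSingularities.Theorems.EquisingularLiftEquisingularLiftNatInvStepSingular
import Summits.ResolutionOfSingularities.ResolutionOfSingularities.Theorems.EquisingularLiftEquisingularLiftNatCentredPointStepExcl
import Summits.ResolutionOfSingularities.ResolutionOfSingularities.Theorems.EquisingularLiftEquisingularLiftNatTCPlusPlusInvDefs
import HarnessLib

/-!
# [OURS · L1 W4.5(b) · EL♮(3)] (δ) ASSEMBLY brick `inv_step″`: THE TC⁺⁺ INVARIANT IS PRESERVED BY THE `ClusterReach` STEP — the `(step)`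
# hypothesis of res-L1-w45b-stub-3's driver `hsub_reachTCPlusPlus_of_invariant` (p543222) at `INV := TCPlusPlus.Inv` (p547095), VERBATIM

Crux chain w45b (cell `res-hironaka`, slot W4.5(b)), working crux **EL♮** = stmt-ResolutionOfSingularities-20038, child **EL♮(3)** =
stmt-ResolutionOfSingularities-20148, route EquisingularLift, line `sections`, registered stub `stub_elnat_tcPlusPlusPointResolution` (v2).
HONEST FRAMING: OURS; NOT a statement of any manuscript; AI-written, weaker than expert review. No `sorry`; standard axioms. DEF-FREE.
`--supports stmt-ResolutionOfSingularities-20148 --as helper` (res-type-100 g12; CHAIN v7.29 ask (e) «then the first (δ) ASSEMBLY filing»).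

WHAT.
* `exists_cand_descends` — **a candidate centre of the new stage lies over a candidate centre `≠ y` of the old stage**: blow up a closed
  point `y` of the reduced running curve `V(closure Z)_red` (`υ₁ : G₂ → G₁`); a closed NON-regular point `z′` of the new reduced curve
  `V(closure Z′)_red`, `Z′ = closure υ₁⁻¹(Z ∖ {y})`, outside the new tracker `X′ = closure υ₁⁻¹(X ∖ {y}) ∪ υ₁⁻¹{y}` lies over a closed
  non-regular point `y₁ ≠ y` of the old curve outside `X` (res-L1-w45b-stub-4's …NatSingularPointDescends: off the centre the induced map of
  reduced curves is a local isomorphism); and `υ₁` is injective off its centre (`existsUnique_preimage`). Hence for `S′ ⊆ Cand′`: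
  `S := υ₁ '' S′ ⊆ Cand ∖ {y}` and `υ₁⁻¹ S = S′`.
* **`inv_step''`** — the driver's `(step)` binder at `INV := TCPlusPlus.Inv O k θ P q Y Ch`: at a REGULAR point of the curve every member
  `S := υ₁ '' S′` steps by res-L1-w45b-stub-4's (A) `member_strictTransform_of_regularPoint` (p541999; `y ∉ S`); at a NON-REGULAR point
  `y ∉ X` (a candidate itself) the member indexed by `S ∪ {y}` steps by res-L1-w45b-stub-1's (ε)-CORE `member_strictTransform_of_centredPoint_excl`
  (p545787) to the member indexed by `υ₁⁻¹((S ∪ {y}) ∖ {y}) = S′`; the clause `T′ ⊄ closure Z′` by res-L1-w45b-stub-1's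
  `not_closure_preimage_diff_subset_of_isBlowup_point`.

References: res-L1-w45b-stub-4 …NatInvStepRegular (p543848), …NatMemberStepRegular (p541999), …NatSingularPointDescends (p526913);
res-L1-w45b-stub-1 …NatInvStepSingular (p543070), …NatCentredPointStepExcl (p545787); res-D-pv-029 …NatCentredPackageTransport (p541005).
[cite: Liu2002, Thm. 8.1.19; StacksProject, Tag 02OS]
-/

set_option linter.dupNamespace false -- mandated namespace `Summit.<Summit>.<Problem>` of this single-conjunct summit
set_option linter.overlappingInstances false -- signatures carry `[IsDomain O] [IsDiscreteValuationRing O]`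

noncomputable section

open CategoryTheory CategoryTheory.Limits AlgebraicGeometry TopologicalSpace Topology IsLocalRing
open Literature.AlgebraicGeometry.Resolution
open AlgebraicGeometry.Scheme.IdealSheafData
open Summit.ResolutionOfSingularities.ResolutionOfSingularities.Theses.EquisingularLift.Split
open Summit.ResolutionOfSingularities.ResolutionOfSingularities.Cruxes.EquisingularLift.StrataSplit

namespace Summit.ResolutionOfSingularities.ResolutionOfSingularities.Cruxes.EquisingularLiftNat.Sections

/-! ## 1. Candidate centres descend along a point step, off the blown-up point -/

/-- **A candidate centre of the new stage lies over a candidate centre `≠ y` of the old stage** (see the module docstring).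
[cite: StacksProject, Tag 02OS] [OURS · L1 W4.5b] -/
theorem exists_cand_descends {G₁ G₂ : Scheme.{0}} [IsLocallyNoetherian G₁] [IsLocallyNoetherian G₂] (Z X : Set G₁)
    (y : redSub G₁ (closure Z) isClosed_closure) (hy : IsClosed ({(redSubι G₁ (closure Z) isClosed_closure y : G₁)} : Set G₁))
    (υ₁ : G₂ ⟶ G₁) (hυ₁ : IsBlowup υ₁ (vanishingIdeal ⟨{(redSubι G₁ (closure Z) isClosed_closure y : G₁)}, hy⟩))
    (z' : G₂) (hz' : z' ∈ TCPlusPlus.Cand G₂ (closure (υ₁ ⁻¹' (Z \ {(redSubι G₁ (closure Z) isClosed_closure y : G₁)})))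
      (closure (υ₁ ⁻¹' (X \ {(redSubι G₁ (closure Z) isClosed_closure y : G₁)})) ∪
        υ₁ ⁻¹' {(redSubι G₁ (closure Z) isClosed_closure y : G₁)})) :
    υ₁ z' ≠ (redSubι G₁ (closure Z) isClosed_closure y : G₁) ∧ υ₁ z' ∈ TCPlusPlus.Cand G₁ Z X ∧
      ∀ z'' : G₂, υ₁ z'' = υ₁ z' → z'' = z' := by
  classical
  haveI : IsProper υ₁ := hυ₁.isProper
  obtain ⟨hz'cl, hz'X, z'', hz''z', hz''sing⟩ := hz'
  have hne : υ₁ z' ≠ (redSubι G₁ (closure Z) isClosed_closure y : G₁) := fun h => hz'X (Or.inr h)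
  -- off the centre the blow-up is injective
  have hnot : υ₁ z' ∈ (⟨((vanishingIdeal (⟨{(redSubι G₁ (closure Z) isClosed_closure y : G₁)}, hy⟩ : Closeds G₁)).support : Set G₁)ᶜ,
      (vanishingIdeal (⟨{(redSubι G₁ (closure Z) isClosed_closure y : G₁)}, hy⟩ : Closeds G₁)).support.isClosed.isOpen_compl⟩ :
        G₁.Opens) := by
    change υ₁ z' ∈ ((vanishingIdeal (⟨{(redSubι G₁ (closure Z) isClosed_closure y : G₁)}, hy⟩ : Closeds G₁)).support : Set G₁)ᶜ
    rw [Scheme.IdealSheafData.coe_support_vanishingIdeal]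
    exact hne
  have huniq : ∀ z'' : G₂, υ₁ z'' = υ₁ z' → z'' = z' := by
    obtain ⟨z₀, -, hz₀⟩ := existsUnique_preimage υ₁ hυ₁.isIso_compl hnot
    intro z₃ hz₃
    rw [hz₀ z₃ hz₃, hz₀ z' rfl]
  refine ⟨hne, ⟨?_, ?_, ?_⟩, huniq⟩
  · rw [← Set.image_singleton]; exact υ₁.isClosedMap _ hz'cl
  · intro hX
    exact hz'X (Or.inl (subset_closure ⟨hX, hne⟩))
  · -- the non-regular point of the new curve read in the «`closure Z ∖ {y}`» spelling, then descended along `ρ`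
    have e : (vanishingIdeal (⟨closure (closure (υ₁ ⁻¹' (Z \ {(redSubι G₁ (closure Z) isClosed_closure y : G₁)}))), isClosed_closure⟩ :
          Closeds G₂) : G₂.IdealSheafData) =
        vanishingIdeal ⟨closure (υ₁ ⁻¹' (closure Z \ {(redSubι G₁ (closure Z) isClosed_closure y : G₁)})), isClosed_closure⟩ := by
      congr 1
      apply Closeds.ext
      change closure (closure _) = closure _
      rw [closure_closure, closure_preimage_closure_diff_singleton hy hυ₁ Z]
    obtain ⟨z₂, hz₂, hz₂reg⟩ := exists_subschemePoint_of_eq e z''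
    have h₂ : ¬ IsRegularLocalRing _ := fun h => hz''sing (hz₂reg.mp h)
    obtain ⟨-, ρ, hρι, -, -⟩ := exists_isBlowup_reducedStrictTransform_point_closed G₁ G₂ (closure Z) isClosed_closure y hy υ₁ hυ₁
    have hunder : υ₁ ((vanishingIdeal (⟨closure (υ₁ ⁻¹' (closure Z \ {(redSubι G₁ (closure Z) isClosed_closure y : G₁)})),
        isClosed_closure⟩ : Closeds G₂)).subschemeι z₂) = redSubι G₁ (closure Z) isClosed_closure (ρ z₂) := by
      rw [← Scheme.Hom.comp_apply, ← hρι, Scheme.Hom.comp_apply]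
    have hρne : ρ z₂ ≠ y := by
      intro h
      apply hne
      rw [← hz''z', ← hz₂, hunder, h]
    have hsing₁ : ¬ IsRegularLocalRing ((redSub G₁ (closure Z) isClosed_closure).presheaf.stalk (ρ z₂)) :=
      fun h₁ => h₂ ((isRegularLocalRing_stalk_reducedStrictTransform_iff_of_not_over hυ₁ z₂ (ρ z₂) hunder hρne).mpr h₁)
    refine ⟨ρ z₂, ?_, hsing₁⟩
    rw [← hunder, hz₂, hz''z']

/-! ## 2. `inv_step″` -/

set_option maxHeartbeats 800000 in -- long assembly
/-- **THE TC⁺⁺ INVARIANT IS PRESERVED BY THE `ClusterReach` STEP** (the driver's `(step)` at `INV := TCPlusPlus.Inv`; see the module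
docstring). [cite: Liu2002, Thm. 8.1.19; StacksProject, Tag 02OS] [OURS · L1 W4.5b] (δ) assembly toward `stub_elnat_tcPlusPlusPointResolution`;
NOT a statement of the manuscript. -/
theorem inv_step'' (O : Type) [CommRing O] [IsDomain O] [IsDiscreteValuationRing O]
    [IsAdicComplete (maximalIdeal O) O] [IsAlgClosed (ResidueField O)] (k : Type) [Field k] (θ : O →+* k)
    (hθ : Function.Surjective θ)
    (P : Scheme.{0}) (q : P ⟶ Spec (.of O)) (Y : Set P) (hY : Y ⊆ q ⁻¹' {closedPoint O}) (hYirr : IsIrreducible Y)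
    (hYcl : IsClosed Y) [IsProper q] [IsIntegral P] (hPnoeth : IsLocallyNoetherian P) (hPreg : Scheme.IsRegular P)
    [SmoothOfRelativeDimension 3 q]
    (Ch : ∀ X' : Scheme.{0}, (X' ⟶ P) → Set X' → Prop)
    (hChain : ∀ (X' : Scheme.{0}) (σ : X' ⟶ P) (S : Set X'), Ch X' σ S → Chain P Y X' σ S)
    (hStep : ∀ (X' X'' : Scheme.{0}) (σ' : X' ⟶ P) (S' : Set X') (C : X'.IdealSheafData) (τ : X'' ⟶ X'),
      Ch X' σ' S' → IsBlowup τ C → Scheme.IsRegular C.subscheme → Flat (C.subschemeι ≫ σ' ≫ q) →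
      σ' '' (C.support : Set X') ⊆ {x : P | ¬ IsGenericPoint x Y} →
      (C.support : Set X') ∩ (σ' ≫ q) ⁻¹' {closedPoint O} ⊆ S' →
      Ch X'' (τ ≫ σ') (closure (τ ⁻¹' (S' \ (C.support : Set X')))))
    {F₁ F₂ : Scheme.{0}} :
    ∀ W : Set F₁, ∀ (G₁ G₂ : Scheme.{0}) (β : G₁ ⟶ F₂) (T Z X : Set G₁) (y : redSub G₁ (closure Z) isClosed_closure) (υ₁ : G₂ ⟶ G₁)
      (hy : IsClosed ({(redSubι G₁ (closure Z) isClosed_closure y : G₁)} : Set G₁)),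
      TCPlusPlus.Inv O k θ P q Y Ch W G₁ β T Z X → (redSubι G₁ (closure Z) isClosed_closure y : G₁) ∈ T →
      IsRegularLocalRing (G₁.presheaf.stalk (redSubι G₁ (closure Z) isClosed_closure y)) →
      (IsRegularLocalRing ((redSub G₁ (closure Z) isClosed_closure).presheaf.stalk y) ∨
        (¬ IsRegularLocalRing ((redSub G₁ (closure Z) isClosed_closure).presheaf.stalk y) ∧
          (redSubι G₁ (closure Z) isClosed_closure y : G₁) ∉ X)) →
      IsBlowup υ₁ (vanishingIdeal (⟨{(redSubι G₁ (closure Z) isClosed_closure y : G₁)}, hy⟩ : Closeds G₁)) →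
      TCPlusPlus.Inv O k θ P q Y Ch W G₂ (υ₁ ≫ β)
        (closure (υ₁ ⁻¹' (T \ {(redSubι G₁ (closure Z) isClosed_closure y : G₁)})))
        (closure (υ₁ ⁻¹' (Z \ {(redSubι G₁ (closure Z) isClosed_closure y : G₁)})))
        (closure (υ₁ ⁻¹' (X \ {(redSubι G₁ (closure Z) isClosed_closure y : G₁)})) ∪
          υ₁ ⁻¹' {(redSubι G₁ (closure Z) isClosed_closure y : G₁)}) := by
  intro W G₁ G₂ β T Z X y υ₁ hy hInv hyT hamb hcase hυ₁
  classical
  -- the package transport (res-D-pv-029's T-PKG-TRANSPORT-SCHEME `centredPackage_strictTransform`, p541005), for (A)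
  have hpkg : ∀ ⦃X X₂ : Scheme.{0}⦄ [IsIntegral X] [IsLocallyNoetherian X] [IsLocallyNoetherian X₂] (σ : X ⟶ P)
      [IsSeparated (σ ≫ q)], Scheme.IsRegular X → ∀ (s : Spec (.of O) ⟶ X), s ≫ σ ≫ q = 𝟙 _ → ∀ (τ : X₂ ⟶ X), IsBlowup τ s.ker →
      ∀ (𝓢 K : X.IdealSheafData) (p' : X), p' ∉ (s.ker.support : Set X) → ∀ (p'₂ : X₂), τ p'₂ = p' →
      TCPlus.CentredPackage O P q X σ 𝓢 K p' →
      TCPlus.CentredPackage O P q X₂ (τ ≫ σ) (strictTransformIdeal τ s.ker 𝓢) (strictTransformIdeal τ s.ker K) p'₂ :=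
    fun X X₂ _ _ _ σ _ _ s _ τ hτ 𝓢 K p' hp' p'₂ hp'₂ h => centredPackage_strictTransform O P q σ s τ hτ 𝓢 K p' hp' p'₂ hp'₂ h
  obtain ⟨hG₁int, hTcl, hTirr, hTZ, hmemS⟩ := hInv
  haveI := hG₁int
  -- Noetherianity of the stages (from any member's model square)
  haveI : IsClosedImmersion (Spec.map (CommRingCat.ofHom θ)) := IsClosedImmersion.spec_of_surjective _ hθ
  haveI : IsLocallyNoetherian G₁ := by
    obtain ⟨X₀, σ, S, jG, tG, 𝓢, K, -, -, hXnoeth, -, -, hsq, -⟩ := hmemS ∅ (Set.empty_subset _)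
    haveI := hXnoeth
    haveI : IsClosedImmersion jG := MorphismProperty.IsStableUnderBaseChange.of_isPullback hsq.flip inferInstance
    exact LocallyOfFiniteType.isLocallyNoetherian jG
  haveI : IsProper υ₁ := hυ₁.isProper
  haveI : IsLocallyNoetherian G₂ := LocallyOfFiniteType.isLocallyNoetherian υ₁
  have hyZ : (redSubι G₁ (closure Z) isClosed_closure y : G₁) ∈ closure Z := by
    have h1 : (redSubι G₁ (closure Z) isClosed_closure y : G₁) ∈ Set.range (redSubι G₁ (closure Z) isClosed_closure) := ⟨y, rfl⟩
    rw [Scheme.IdealSheafData.range_subschemeι, Scheme.IdealSheafData.coe_support_vanishingIdeal] at h1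
    exact h1
  -- for a subset `S′` of the new candidates: the descended set `S = υ₁ '' S′`
  have hdesc : ∀ S' : Set G₂, S' ⊆ TCPlusPlus.Cand G₂ (closure (υ₁ ⁻¹' (Z \ {(redSubι G₁ (closure Z) isClosed_closure y : G₁)})))
      (closure (υ₁ ⁻¹' (X \ {(redSubι G₁ (closure Z) isClosed_closure y : G₁)})) ∪
        υ₁ ⁻¹' {(redSubι G₁ (closure Z) isClosed_closure y : G₁)}) →
      υ₁ '' S' ⊆ TCPlusPlus.Cand G₁ Z X ∧ (redSubι G₁ (closure Z) isClosed_closure y : G₁) ∉ υ₁ '' S' ∧ υ₁ ⁻¹' (υ₁ '' S') = S' := by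
    intro S' hS'
    refine ⟨?_, ?_, ?_⟩
    · rintro _ ⟨z', hz', rfl⟩
      exact (exists_cand_descends Z X y hy υ₁ hυ₁ z' (hS' hz')).2.1
    · rintro ⟨z', hz', h⟩
      exact (exists_cand_descends Z X y hy υ₁ hυ₁ z' (hS' hz')).1 h
    · ext z₃
      constructor
      · rintro ⟨z', hz', h⟩
        rw [(exists_cand_descends Z X y hy υ₁ hυ₁ z' (hS' hz')).2.2 z₃ h.symm]
        exact hz'
      · exact fun h => ⟨z₃, h, rfl⟩
  rcases hcase with hyreg | ⟨hysing, hyX⟩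
  · -- REGULAR point of the curve: every member steps by (A)
    have hyreg' := isRegularLocalRing_quotient_stalkIdeal_of_subschemePoint _ y hyreg
    have hA := fun (S : Set G₁) (hS : S ⊆ TCPlusPlus.Cand G₁ Z X)
        (hyS : (redSubι G₁ (closure Z) isClosed_closure y : G₁) ∉ S) =>
      member_strictTransform_of_regularPoint O k θ hθ P q Y hY hYirr hYcl hPnoeth hPreg Ch hChain hStep hpkg G₁ T Z S (hmemS S hS)
        hTirr _ hy hyZ hyT hTZ hyS hyreg' hamb G₂ υ₁ hυ₁
    obtain ⟨hG₂int, hirr₂, hT₂Z₂, -⟩ := hA ∅ (Set.empty_subset _) (Set.notMem_empty _)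
    refine ⟨hG₂int, isClosed_closure, hirr₂, hT₂Z₂, fun S' hS' => ?_⟩
    obtain ⟨hS, hyS, hpre⟩ := hdesc S' hS'
    obtain ⟨-, -, -, hmem₂⟩ := hA _ hS hyS
    rw [hpre] at hmem₂
    exact hmem₂
  · -- NON-REGULAR point outside the tracker: the member indexed by `S ∪ {y}` steps by the (ε)-core
    have hTx : ¬ T ⊆ {(redSubι G₁ (closure Z) isClosed_closure y : G₁)} := fun h =>
      hTZ (h.trans (Set.singleton_subset_iff.mpr hyZ))
    have hyC : (redSubι G₁ (closure Z) isClosed_closure y : G₁) ∈ TCPlusPlus.Cand G₁ Z X := ⟨hy, hyX, y, rfl, hysing⟩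
    have hE := fun (S : Set G₁) (hS : S ⊆ TCPlusPlus.Cand G₁ Z X) =>
      member_strictTransform_of_centredPoint_excl O k θ hθ P q Y hY hYirr hYcl hPnoeth hPreg Ch hChain hStep G₁ T Z
        (S ∪ {(redSubι G₁ (closure Z) isClosed_closure y : G₁)}) _ hy hyT hTx (Set.mem_union_right _ (Set.mem_singleton _))
        (hmemS _ (Set.union_subset hS (Set.singleton_subset_iff.mpr hyC))) G₂ υ₁ hυ₁
    obtain ⟨hG₂int, hT₂irr, -⟩ := hE ∅ (Set.empty_subset _)
    refine ⟨hG₂int, isClosed_closure, hT₂irr, not_closure_preimage_diff_subset_of_isBlowup_point υ₁ hy hυ₁ hTZ hyZ,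
      fun S' hS' => ?_⟩
    obtain ⟨hS, hyS, hpre⟩ := hdesc S' hS'
    obtain ⟨-, -, hmem₂⟩ := hE _ hS
    have hset : (υ₁ '' S' ∪ {(redSubι G₁ (closure Z) isClosed_closure y : G₁)}) \ {(redSubι G₁ (closure Z) isClosed_closure y : G₁)} =
        υ₁ '' S' := by
      rw [Set.union_sdiff_right, Set.sdiff_singleton_eq_self hyS]
    rw [hset, hpre] at hmem₂
    exact hmem₂

end Summit.ResolutionOfSingularities.ResolutionOfSingularities.Cruxes.EquisingularLiftNat.Sections

end
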